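import Summits.Ventures.HodgeRepro2.Faces

/-!
# GaloisSextic.lean — a Galois CM field of degree 6 is abelian, indeed cyclic, over `ℚ`

Seat p1 (gen 2) of the blind cell pub-hodge-repro2.  TIER3.md §5(i) asserts, for the sextic Galois
CM field `𝐅` of the brief, "`Gal(𝐅/ℚ) ≅ ℤ/6` — the complex conjugation of a Galois CM field is
central, which excludes `S₃`"; this is the hypothesis "`F` abelian over `ℚ`" of Shimura 1998 §8.4
Example (1) (the reflex of a primitive type is the inverse type), which the instantiation uses.

Kernel-checked here, for every CM field `K` with `K/ℚ` Galois and `[K : ℚ] = 6`: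
* `galConj_mem_center`: complex conjugation lies in the centre of `Gal(K/ℚ)` (from
  `galConj_mul_comm`, Faces.lean);
* `isMulCommutative_gal_of_finrank_six` / `isAbelianGalois_of_finrank_six`: `Gal(K/ℚ)` is
  commutative, i.e. `K/ℚ` is abelian (`G/Z(G)` has order `≤ 3`, hence is cyclic, hence `G` is
  commutative);
* `isCyclic_gal_of_finrank_six`: `Gal(K/ℚ)` is cyclic (complex conjugation has order 2, Cauchy
  gives an element of order 3, their product has order 6);
* `nonempty_mulEquiv_zmod_six`: `Gal(K/ℚ) ≃* Multiplicative (ℤ/6)` — the identification used by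
  the `ℤ/6` model of Sextic.lean part E.
No field is shown to exist with these properties here; the statements are conditional on the
hypotheses `[IsGalois ℚ K]`, `[IsCMField K]`, `finrank ℚ K = 6`.
-/

namespace Summit.Ventures.HodgeRepro2

open NumberField

section GaloisSextic

variable (K : Type*) [Field K] [NumberField K] [IsCMField K]

/-- Complex conjugation is central in `Gal(K/ℚ)` (restatement of `galConj_mul_comm` as
membership in `Subgroup.center`). -/
theorem galConj_mem_center : galConj K ∈ Subgroup.center (K ≃ₐ[ℚ] K) :=
  Subgroup.mem_center_iff.mpr fun g => (galConj_mul_comm K g).symm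

/-- The centre of `Gal(K/ℚ)` has at least two elements, `1` and complex conjugation. -/
theorem two_le_card_center : 2 ≤ Nat.card (Subgroup.center (K ≃ₐ[ℚ] K)) := by
  have hnt : Nontrivial (Subgroup.center (K ≃ₐ[ℚ] K)) :=
    ⟨⟨⟨1, Subgroup.one_mem _⟩, ⟨galConj K, galConj_mem_center K⟩,
      fun h => galConj_ne_one K (congrArg Subtype.val h).symm⟩⟩
  exact Finite.one_lt_card_iff_nontrivial.mpr hnt

/-- Complex conjugation has order exactly 2 in `Gal(K/ℚ)`. -/
theorem orderOf_galConj : orderOf (galConj K) = 2 :=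
  orderOf_eq_prime (by rw [pow_two]; exact galConj_mul_self K) (galConj_ne_one K)

variable [IsGalois ℚ K] (h6 : Module.finrank ℚ K = 6)
include h6

/-- `[K : ℚ] = 6` and `|Z(G)| ≥ 2` force `|G/Z(G)| ≤ 3`. -/
theorem card_quotient_center_le_three :
    Nat.card ((K ≃ₐ[ℚ] K) ⧸ Subgroup.center (K ≃ₐ[ℚ] K)) ≤ 3 := by
  have hc := Subgroup.card_eq_card_quotient_mul_card_subgroup (Subgroup.center (K ≃ₐ[ℚ] K))
  rw [IsGalois.card_aut_eq_finrank, h6] at hc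
  have h2 := two_le_card_center K
  nlinarith

/-- `G/Z(G)` is cyclic (order `1`, `2` or `3`). -/
theorem isCyclic_quotient_center :
    IsCyclic ((K ≃ₐ[ℚ] K) ⧸ Subgroup.center (K ≃ₐ[ℚ] K)) := by
  have hle := card_quotient_center_le_three K h6
  have hpos : 0 < Nat.card ((K ≃ₐ[ℚ] K) ⧸ Subgroup.center (K ≃ₐ[ℚ] K)) := Nat.card_pos
  interval_cases h : Nat.card ((K ≃ₐ[ℚ] K) ⧸ Subgroup.center (K ≃ₐ[ℚ] K))
  · exact @isCyclic_of_subsingleton _ _ (Finite.card_le_one_iff_subsingleton.mp h.le)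
  · exact isCyclic_of_prime_card h
  · exact isCyclic_of_prime_card h

/-- **A Galois CM field of degree 6 has commutative Galois group** (`G/Z(G)` cyclic ⇒ `G`
commutative): TIER3 §5(i), "excludes `S₃`". -/
theorem isMulCommutative_gal_of_finrank_six : IsMulCommutative (K ≃ₐ[ℚ] K) :=
  haveI := isCyclic_quotient_center K h6
  (QuotientGroup.mk' (Subgroup.center (K ≃ₐ[ℚ] K))).isMulCommutative_of_isCyclic_of_ker_le_center
    (by rw [QuotientGroup.ker_mk'])

/-- **A Galois CM field of degree 6 is abelian over `ℚ`** — the hypothesis of Shimura 1998 §8.4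
Example (1) ("if `F` is abelian over `ℚ` and `(F; {φ_i})` is primitive, the reflex of `(F; {φ_i})`
is `(F; {φ_i⁻¹})`"). -/
theorem isAbelianGalois_of_finrank_six : IsAbelianGalois ℚ K :=
  { toIsGalois := inferInstance
    toIsMulCommutative := isMulCommutative_gal_of_finrank_six K h6 }

/-- **`Gal(K/ℚ)` is cyclic of order 6**: complex conjugation (order 2) times an element of order 3
(Cauchy) has order 6. -/
theorem isCyclic_gal_of_finrank_six : IsCyclic (K ≃ₐ[ℚ] K) := by
  have hcomm := isMulCommutative_gal_of_finrank_six K h6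
  have hcard : Nat.card (K ≃ₐ[ℚ] K) = 6 := by rw [IsGalois.card_aut_eq_finrank, h6]
  have h3 : (3 : ℕ) ∣ Fintype.card (K ≃ₐ[ℚ] K) := by
    rw [← Nat.card_eq_fintype_card, hcard]
    norm_num
  obtain ⟨b, hb⟩ := exists_prime_orderOf_dvd_card 3 h3
  have hcm : Commute (galConj K) b := hcomm.is_comm.comm _ _
  have hco : Nat.Coprime (orderOf (galConj K)) (orderOf b) := by
    rw [orderOf_galConj, hb]
    norm_num
  have hord : orderOf (galConj K * b) = Nat.card (K ≃ₐ[ℚ] K) := by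
    rw [hcm.orderOf_mul_eq_mul_orderOf_of_coprime hco, orderOf_galConj, hb, hcard]
  exact isCyclic_of_orderOf_eq_card _ hord

/-- `Gal(K/ℚ) ≃* Multiplicative (ℤ/6)` — the identification behind the `ℤ/6` model of
Sextic.lean part E (TIER3 §5(i) "`Gal(𝐅/ℚ) ≅ ℤ/6`"). -/
theorem nonempty_mulEquiv_zmod_six :
    Nonempty (Multiplicative (ZMod 6) ≃* (K ≃ₐ[ℚ] K)) := by
  have hcard : Nat.card (K ≃ₐ[ℚ] K) = 6 := by rw [IsGalois.card_aut_eq_finrank, h6]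
  have e := zmodCyclicMulEquiv (isCyclic_gal_of_finrank_six K h6)
  rw [hcard] at e
  exact ⟨e⟩

end GaloisSextic

end Summit.Ventures.HodgeRepro2
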